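import Summits.QuantumFields.BalabanUV.Beta.GAN24.BornBorderLiftChain
import Summits.QuantumFields.BalabanUV.Beta.GAN24.BornBorderLetters
import Summits.QuantumFields.BalabanUV.Beta.GAN24.LagrIncLevelZero

/-!
# GAN24 ∕ BORNSEC, V half — `BornBorderUndressedRow`: THE UNDRESSED V-LINEAGE LETTER `hUg` FROM ROAD S3's ROOTED SYMMETRIC-TABLE ROWS (`d = 3`)

NOT IN PRINT; OUR BOOKKEEPING ([folklore] finite lattice algebra over tree names; no estimate of Bałaban's is formalised, cited or discharged here).
HONEST: discharges NOTHING of `hB` ∕ `(hS, hSall)` by itself — the END theorems are CONDITIONAL on three rooted road-S3 V rows (hypotheses `hV`, `hVt`, `hV0`,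
the symmetric-table twins `TaylorRowVSymAt.rowV_three_at` ∕ `S3ShapeVtSymAt.shapeVt_three_at` ∕ `S3RowV0SymAt.shapeV0_at` of gan24-p2); NEVER «G-an2-4 closed»;
NOT (CONV-C), NOT D1, NOT `BetaPertH`, NOT continuum, NOT Clay.

WHAT (the V twin of `BornLambdaUndressedRow`).  leaf-01's (V-1) socket `BornBorderLetters.exists_hUv_of_geometric` wants, for every lineage `i < k` and every in-block root,
`LocStencil ((cE·Lc^{2(d+1)})^{k−i} • push₃ B′ B′ B′ Y⁰_i) (C·θ^{k−i}) δ`.  At the pin `cE = Lc^4`, `d = 3` each such member IS `Lc^4` times one of road S3's rooted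
symmetric-table row objects (§2: `BornBorderLiftChain.lineage_v_eq_e3OfS_pushSum` for `k ≥ i+2`, `BornBorderLift.undressedStepV_eq_e3OfS_borderSum` + leaf-01's
`push₃_respStep_self` for the top member `k = i+1 ≥ 2`, `borderSum 1 = id` for the birth level `i = 0`), except the lone member `(i,k) = (0,1)`, a fixed local family (§1).
§3 assembles `exists_hUgV_of_rootedRows` and composes with leaf-01's letters: `exists_hBv_of_rootedRows_poly` — `hB(cVH,0)` ⇐ `hV ∧ hVt ∧ hV0 ∧ hCg` (the V contact letter).

Unit `b2b-balaban-gan24-p1` (row owner G-an2-4, gen 21), 2026-08-21.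
-/

noncomputable section

open Finset
open scoped BigOperators
open Literature.MathematicalPhysics.QuantumFieldTheory
open Literature.MathematicalPhysics.QuantumFieldTheory.Balaban1983to89
open Literature.MathematicalPhysics.QuantumFieldTheory.Balaban1983to89.Beta
open ExpKernelCalculus (MKer Decays)
open OneStepResolventKernel (Fib LocStencil KInv)
open BalabanStepJets (locStencil_mono)
open StepJetData (locStencil_add locStencil_smul)
open AffineAveraging (box toSite)
open AveragingHessianKernels (ell)
open AveragingHessianKernelsRooted (vhSAt locStencil_vhSAt)
open Summit.QuantumFields.BalabanUV.Beta.GAN24.CombesThomas (sfStep smStep KStepUnit)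
open BalabanCompositeJets (respStep pushSum bshift)
open DecLiftAdjoint (borderSum)
open InterLevelTransport (avgLift)
open Summit.QuantumFields.BalabanUV.Beta.GAN24.Push4Bounds (LegDecay)
open Summit.QuantumFields.BalabanUV.Beta.GAN24.Push3 (push₃ locStencil_push₃_mono locStencil_neg)
open Summit.QuantumFields.BalabanUV.Beta.GAN24.E3UnitSplit (e3OfS)
open Summit.QuantumFields.BalabanUV.Beta.GAN24.SrecLinearPartEq (colM rowMM reslot legDecay_colM legDecay_rowMM locStencil_reslot)
open Summit.QuantumFields.BalabanUV.Beta.HessKerDressedUnits (unitS)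
open Summit.QuantumFields.BalabanUV.Beta.GAN24.SrecWilsonSector (bornSecAt)
open Summit.QuantumFields.BalabanUV.Beta.GAN24.RespStepBmDecompPsi (legDecay_respStep_of_decays decays_KStepUnit_levels)
open Summit.QuantumFields.BalabanUV.Beta.GAN24.StencilSlotOfShapes (locStencil_mono')
open Summit.QuantumFields.BalabanUV.Beta.GAN24.BornLambdaUndressedRow (e3OfS_smul)
open Summit.QuantumFields.BalabanUV.Beta.GAN24.BornBorderLift (undressedStepV_eq_e3OfS_borderSum)
open Summit.QuantumFields.BalabanUV.Beta.GAN24.BornBorderLiftChain (lineage_v_eq_e3OfS_pushSum legDecay_neg exists_legDecay_respStep borderSum_smul)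
open Summit.QuantumFields.BalabanUV.Beta.GAN24.BornBorderLetters (push₃_respStep_self isFF_twoPush exists_hBv_of_geometric exists_hBv_of_geometric_poly)

namespace Summit.QuantumFields.BalabanUV.Beta.GAN24.BornBorderUndressedRow

variable {d : ℕ} {Lc : ℕ} [NeZero Lc]

/-! ## §1 Two small identities and the lone member `(0, 1)` -/

omit [NeZero Lc] in
/-- [folklore] At blocking `1` the border sum is the family itself (`range 1 = {0}`, `bshift κ 0 = 0`, `quo 1 = id`, `avgLift 1 = id`). -/
theorem borderSum_one (G : Fin (d + 1) → (Fin (d + 1) → ℤ) → MKer (d + 1) (Fib d)) (κ : Fin (d + 1)) (u : Fin (d + 1) → ℤ) :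
    borderSum 1 G κ u = G κ u := by
  have hb : bshift d κ 0 = 0 := by funext j; simp [bshift]
  funext x w a b
  simp only [borderSum, Finset.range_one, Finset.sum_singleton, hb, sub_zero, ResolventComposition.quo_one, LagrIncLevelZero.avgLift_one]

/-- NOT IN PRINT; OUR BOOKKEEPING ([folklore]).  **THE LONE MEMBER `(i,k) = (0,1)` IS A LOCAL STENCIL FAMILY**, one constant for all in-block roots: the inner one-step
pushes are local (`Push3.locStencil_push₃_mono` with an2's `decays_KStepUnit_levels 0`), and so is their push by the (diagonal) legs `respStep Lc Lc` (blocking `1`). -/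
theorem exists_locStencil_v_member_zero_one (hLc : 1 ≤ Lc) (w cVH : ℝ) :
    ∃ C δ : ℝ, 0 < δ ∧ ∀ (rr : Fin (d + 1) → ℕ), rr ∈ box (d + 1) Lc →
      LocStencil (fun κ' u' => w •
        push₃ (respStep (d := d) (Lc ^ (0 + 1)) (Lc ^ 1)) (respStep (d := d) (Lc ^ (0 + 1)) (Lc ^ 1)) (respStep (d := d) (Lc ^ (0 + 1)) (Lc ^ 1))
          (fun κ u => -(push₃ (-respStep (d := d) (Lc ^ 0) (Lc ^ (0 + 1))) (colM (KStepUnit (d := d) Lc 0) Lc)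
                (respStep (d := d) (Lc ^ 0) (Lc ^ (0 + 1))) (reslot Sum.inl Sum.inr fun κ u => cVH • vhSAt (toSite rr) d Lc rfl κ u) κ u
            + push₃ (rowMM (KStepUnit (d := d) Lc 0) Lc) (respStep (d := d) (Lc ^ 0) (Lc ^ (0 + 1)))
                (respStep (d := d) (Lc ^ 0) (Lc ^ (0 + 1))) (reslot Sum.inr Sum.inl fun κ u => cVH • vhSAt (toSite rr) d Lc rfl κ u) κ u)) κ' u') C δ := by
  obtain ⟨CK, mK, hmK, hK⟩ := decays_KStepUnit_levels (d := d) (Lc := Lc) 0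
  obtain ⟨C', m', hm', hB'⟩ := exists_legDecay_respStep (d := d) (M' := Lc ^ (0 + 1)) (R := 1) (N := Lc ^ 1) (by rw [mul_one, zero_add])
  have hR0 := legDecay_respStep_of_decays hK
  -- one rate below `1`, `mK/2` and `m'/2`
  obtain ⟨δ₁, hδ₁, hδ₁1, h2K, h2B⟩ : ∃ δ₁ : ℝ, 0 < δ₁ ∧ δ₁ ≤ 1 ∧ 2 * δ₁ < mK ∧ 2 * δ₁ < m' :=
    ⟨min 1 (min (mK / 4) (m' / 4)), lt_min one_pos (lt_min (by linarith) (by linarith)), min_le_left _ _,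
      by linarith [min_le_right (1 : ℝ) (min (mK / 4) (m' / 4)), min_le_left (mK / 4) (m' / 4)],
      by linarith [min_le_right (1 : ℝ) (min (mK / 4) (m' / 4)), min_le_right (mK / 4) (m' / 4)]⟩
  set Cs : ℝ := |cVH| * (3 * (ell (d + 1) Lc : ℝ) ^ 2 * Real.exp (4 * ((d : ℝ) + 1) * Lc * 1)) with hCs
  refine ⟨|w| * (Push3.cPush₃ d C' C' C' m' δ₁ * (Push3.cPush₃ d CK CK CK mK δ₁ * Cs + Push3.cPush₃ d CK CK CK mK δ₁ * Cs)), δ₁, hδ₁,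
    fun rr hrr => ?_⟩
  have hV : LocStencil (fun κ u => cVH • vhSAt (toSite rr) d Lc rfl κ u) Cs 1 := locStencil_smul cVH (locStencil_vhSAt hLc hrr zero_le_one)
  have hCs0 : 0 ≤ Cs := (hV 0 0).nonneg (Sum.inl 0)
  have hA := locStencil_push₃_mono hLc (legDecay_neg hR0) (legDecay_colM (N := Lc) hK) hR0
    (locStencil_mono (locStencil_reslot hV Sum.inl Sum.inr) hCs0 hδ₁1) hδ₁.le h2K
  have hBm := locStencil_push₃_mono hLc (legDecay_rowMM (N := Lc) hK) hR0 hR0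
    (locStencil_mono (locStencil_reslot hV Sum.inr Sum.inl) hCs0 hδ₁1) hδ₁.le h2K
  have hY := locStencil_neg (locStencil_add hA hBm)
  exact locStencil_smul w (locStencil_push₃_mono le_rfl hB' hB' hB' hY hδ₁.le h2B)

/-! ## §2 `d = 3`, `cE = Lc^4`: each weighted member is `Lc^4` times a rooted road-S3 row value -/

section Pin

variable {Lc : ℕ} [NeZero Lc]

/-- NOT IN PRINT; OUR BOOKKEEPING ([folklore]).  **BIRTH `j+1`, READ `j+n+3`** (`k − i = n+2 ≥ 2`): the weighted undressed member equals `Lc^4` times road S3's symmetric-table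
row-V value at `(n′, m) = (j+n+1, j)` (`BornBorderLiftChain.lineage_v_eq_e3OfS_pushSum`; `Lc^{12(n+2)}·(Lc^(j+1))^{8+5} = Lc^4·Lc^{8(j+n+3)}·Lc^{4(n+1)}·(Lc^(j+1))^5`). -/
theorem lineage_v_succ_pin_apply (hLc : 1 ≤ Lc) {rr : Fin (3 + 1) → ℕ} (hrr : rr ∈ box (3 + 1) Lc) {cE : ℝ} (hcE : cE = (Lc : ℝ) ^ (3 + 1))
    (cVH : ℝ) (j n : ℕ) (κ' : Fin (3 + 1)) (u' x' z' : Fin (3 + 1) → ℤ) (a b : Fib 3) :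
    ((cE * (Lc : ℝ) ^ (2 * (3 + 1))) ^ (n + 1 + 1) •
        push₃ (respStep (d := 3) (Lc ^ (j + 1 + 1)) (Lc ^ (j + 1 + (n + 1) + 1))) (respStep (d := 3) (Lc ^ (j + 1 + 1)) (Lc ^ (j + 1 + (n + 1) + 1)))
          (respStep (d := 3) (Lc ^ (j + 1 + 1)) (Lc ^ (j + 1 + (n + 1) + 1)))
          (fun κ u => -(push₃ (-respStep (d := 3) (Lc ^ (j + 1)) (Lc ^ (j + 1 + 1))) (colM (KStepUnit (d := 3) Lc (j + 1)) Lc)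
                (respStep (d := 3) (Lc ^ (j + 1)) (Lc ^ (j + 1 + 1))) (reslot Sum.inl Sum.inr fun κ u => cVH • vhSAt (toSite rr) 3 Lc rfl κ u) κ u
            + push₃ (rowMM (KStepUnit (d := 3) Lc (j + 1)) Lc) (respStep (d := 3) (Lc ^ (j + 1)) (Lc ^ (j + 1 + 1)))
                (respStep (d := 3) (Lc ^ (j + 1)) (Lc ^ (j + 1 + 1))) (reslot Sum.inr Sum.inl fun κ u => cVH • vhSAt (toSite rr) 3 Lc rfl κ u) κ u))
          κ' u') x' z' a b
      = (Lc : ℝ) ^ (3 + 1) * (((Lc : ℝ) ^ (j + (n + 1) + 1 + 1)) ^ (2 * (3 + 1)) *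
          e3OfS (Lc ^ (j + (n + 1) + 1 + 1)) (fun κ u => (((Lc : ℝ) ^ (3 + 1)) ^ (j + (n + 1) - j) * (cVH * ((Lc : ℝ) ^ (j + 1)) ^ (3 + 2))) •
            pushSum (Lc ^ (j + 1 + 1)) (Lc ^ (j + (n + 1) - j)) (borderSum (Lc ^ (j + 1)) (fun κ z => vhSAt (toSite rr) 3 Lc rfl κ z) κ u))
            κ' u' x' z' a b) := by
  have hN : Lc ^ (j + 1 + (n + 1) + 1) = Lc ^ (j + 1 + 1) * Lc ^ (n + 1) := by rw [← pow_add]; ring_nf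
  rw [Nat.add_sub_cancel_left, show j + (n + 1) + 1 + 1 = j + 1 + (n + 1) + 1 by ring,
    Pi.smul_apply, Pi.smul_apply, Pi.smul_apply, Pi.smul_apply, smul_eq_mul,
    lineage_v_eq_e3OfS_pushSum (d := 3) hLc hrr cVH (j + 1) hN κ' u', e3OfS_smul, e3OfS_smul,
    Pi.smul_apply, Pi.smul_apply, Pi.smul_apply, Pi.smul_apply, smul_eq_mul,
    Pi.smul_apply, Pi.smul_apply, Pi.smul_apply, Pi.smul_apply, smul_eq_mul]
  subst hcE
  simp only [smStep]
  ring

/-- NOT IN PRINT; OUR BOOKKEEPING ([folklore]).  **BIRTH `0`, READ `n+2`**: the weighted undressed member equals `Lc^4` times road S3's symmetric-table row-V0 value at `n`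
(`borderSum 1 = id`, `smStep d Lc 0 = 1`; `Lc^{12(n+2)} = Lc^4·Lc^{8(n+2)}·Lc^{4(n+1)}`). -/
theorem lineage_v_zero_pin_apply (hLc : 1 ≤ Lc) {rr : Fin (3 + 1) → ℕ} (hrr : rr ∈ box (3 + 1) Lc) {cE : ℝ} (hcE : cE = (Lc : ℝ) ^ (3 + 1))
    (cVH : ℝ) (n : ℕ) (κ' : Fin (3 + 1)) (u' x' z' : Fin (3 + 1) → ℤ) (a b : Fib 3) :
    ((cE * (Lc : ℝ) ^ (2 * (3 + 1))) ^ (n + 1 + 1) •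
        push₃ (respStep (d := 3) (Lc ^ (0 + 1)) (Lc ^ (0 + (n + 1) + 1))) (respStep (d := 3) (Lc ^ (0 + 1)) (Lc ^ (0 + (n + 1) + 1)))
          (respStep (d := 3) (Lc ^ (0 + 1)) (Lc ^ (0 + (n + 1) + 1)))
          (fun κ u => -(push₃ (-respStep (d := 3) (Lc ^ 0) (Lc ^ (0 + 1))) (colM (KStepUnit (d := 3) Lc 0) Lc)
                (respStep (d := 3) (Lc ^ 0) (Lc ^ (0 + 1))) (reslot Sum.inl Sum.inr fun κ u => cVH • vhSAt (toSite rr) 3 Lc rfl κ u) κ u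
            + push₃ (rowMM (KStepUnit (d := 3) Lc 0) Lc) (respStep (d := 3) (Lc ^ 0) (Lc ^ (0 + 1)))
                (respStep (d := 3) (Lc ^ 0) (Lc ^ (0 + 1))) (reslot Sum.inr Sum.inl fun κ u => cVH • vhSAt (toSite rr) 3 Lc rfl κ u) κ u))
          κ' u') x' z' a b
      = (Lc : ℝ) ^ (3 + 1) * (((Lc : ℝ) ^ (n + 1 + 1)) ^ (2 * (3 + 1)) *
          e3OfS (Lc ^ (n + 1 + 1)) (fun κ u => ((((Lc : ℝ) ^ (3 + 1)) ^ (n + 1)) * cVH) •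
            pushSum Lc (Lc ^ (n + 1)) (vhSAt (toSite rr) 3 Lc rfl κ u)) κ' u' x' z' a b) := by
  have hN : Lc ^ (0 + (n + 1) + 1) = Lc ^ (0 + 1) * Lc ^ (n + 1) := by rw [← pow_add]; ring_nf
  rw [Pi.smul_apply, Pi.smul_apply, Pi.smul_apply, Pi.smul_apply, smul_eq_mul,
    lineage_v_eq_e3OfS_pushSum (d := 3) hLc hrr cVH 0 hN κ' u']
  have e : (fun κ u => (cVH * smStep 3 Lc 0 ^ 2 * ((Lc : ℝ) ^ 0) ^ (3 + 2)) •
        pushSum (Lc ^ (0 + 1)) (Lc ^ (n + 1)) (borderSum (Lc ^ 0) (fun κ z => vhSAt (toSite rr) 3 Lc rfl κ z) κ u))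
      = fun κ u => cVH • pushSum Lc (Lc ^ (n + 1)) (vhSAt (toSite rr) 3 Lc rfl κ u) := by
    funext κ u
    rw [pow_zero, pow_zero, borderSum_one, zero_add, pow_one]
    simp [smStep]
  rw [e, show 0 + (n + 1) + 1 = n + 1 + 1 by omega, e3OfS_smul, e3OfS_smul,
    Pi.smul_apply, Pi.smul_apply, Pi.smul_apply, Pi.smul_apply, smul_eq_mul,
    Pi.smul_apply, Pi.smul_apply, Pi.smul_apply, Pi.smul_apply, smul_eq_mul]
  subst hcE
  ring

/-- NOT IN PRINT; OUR BOOKKEEPING ([folklore]; the top member `k = i+1 = j+2 ≥ 2`).  **BIRTH `j+1`, READ `j+2`**: the identity-leg push is the identity on the ff-valued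
one-step image (leaf-01's `push₃_respStep_self`), and `(cE·Lc^8) • Y⁰_{j+1}` is `e3OfS` of the border sum (PART 1's `undressedStepV_eq_e3OfS_borderSum`), hence `Lc^4` times
road S3's symmetric-table row-Vt value at `n′ = j` (`Lc^{12}·(Lc^(j+1))^{8+5} = Lc^4·Lc^{8(j+2)}·(Lc^(j+1))^5`). -/
theorem lineage_v_top_pin_apply (hLc : 1 ≤ Lc) {rr : Fin (3 + 1) → ℕ} (hrr : rr ∈ box (3 + 1) Lc) {cE : ℝ} (hcE : cE = (Lc : ℝ) ^ (3 + 1))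
    (cVH : ℝ) (j : ℕ) (κ' : Fin (3 + 1)) (u' x' z' : Fin (3 + 1) → ℤ) (a b : Fib 3) :
    ((cE * (Lc : ℝ) ^ (2 * (3 + 1))) ^ 1 •
        push₃ (respStep (d := 3) (Lc ^ (j + 1 + 1)) (Lc ^ (j + 1 + 1))) (respStep (d := 3) (Lc ^ (j + 1 + 1)) (Lc ^ (j + 1 + 1)))
          (respStep (d := 3) (Lc ^ (j + 1 + 1)) (Lc ^ (j + 1 + 1)))
          (fun κ u => -(push₃ (-respStep (d := 3) (Lc ^ (j + 1)) (Lc ^ (j + 1 + 1))) (colM (KStepUnit (d := 3) Lc (j + 1)) Lc)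
                (respStep (d := 3) (Lc ^ (j + 1)) (Lc ^ (j + 1 + 1))) (reslot Sum.inl Sum.inr fun κ u => cVH • vhSAt (toSite rr) 3 Lc rfl κ u) κ u
            + push₃ (rowMM (KStepUnit (d := 3) Lc (j + 1)) Lc) (respStep (d := 3) (Lc ^ (j + 1)) (Lc ^ (j + 1 + 1)))
                (respStep (d := 3) (Lc ^ (j + 1)) (Lc ^ (j + 1 + 1))) (reslot Sum.inr Sum.inl fun κ u => cVH • vhSAt (toSite rr) 3 Lc rfl κ u) κ u))
          κ' u') x' z' a b
      = (Lc : ℝ) ^ (3 + 1) * (((Lc : ℝ) ^ (j + 1 + 1)) ^ (2 * (3 + 1)) *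
          e3OfS (Lc ^ (j + 1 + 1)) (fun κ u => (cVH * ((Lc : ℝ) ^ (j + 1)) ^ (3 + 2)) •
            borderSum (Lc ^ (j + 1)) (fun κ z => vhSAt (toSite rr) 3 Lc rfl κ z) κ u) κ' u' x' z' a b) := by
  rw [pow_one, push₃_respStep_self _ _ κ' u' (isFF_twoPush _ _ _ _ _ _ _ _ κ' u')]
  have h := undressedStepV_eq_e3OfS_borderSum (d := 3) hLc hrr cE cVH (j + 1) κ' u'
  have e : (fun κ u => (cE * (Lc : ℝ) ^ (2 * (3 + 1)) * smStep 3 Lc (j + 1) ^ 2 * (((Lc : ℝ) ^ (j + 1)) ^ (3 + 2))) •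
        borderSum (Lc ^ (j + 1)) (fun κ u => cVH • vhSAt (toSite rr) 3 Lc rfl κ u) κ u)
      = fun κ u => (cE * (Lc : ℝ) ^ (2 * (3 + 1)) * smStep 3 Lc (j + 1) ^ 2 * (((Lc : ℝ) ^ (j + 1)) ^ (3 + 2)) * cVH) •
        borderSum (Lc ^ (j + 1)) (fun κ z => vhSAt (toSite rr) 3 Lc rfl κ z) κ u := by
    funext κ u; rw [borderSum_smul, smul_smul]
  rw [e] at h
  rw [h, e3OfS_smul, e3OfS_smul, Pi.smul_apply, Pi.smul_apply, Pi.smul_apply, Pi.smul_apply, smul_eq_mul,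
    Pi.smul_apply, Pi.smul_apply, Pi.smul_apply, Pi.smul_apply, smul_eq_mul]
  subst hcE
  simp only [smStep]
  ring

end Pin

/-! ## §3 `d = 3`: the undressed V-lineage letter `hUg` from road S3's three symmetric-table V rows at the in-block root -/

section Socket

variable {Lc : ℕ} [NeZero Lc]

/-- NOT IN PRINT; OUR BOOKKEEPING ([folklore]; CONDITIONAL on the three rooted rows).  **leaf-01's LETTER `hUg` FOR THE V HALF** (the hypothesis of
`BornBorderLetters.exists_hUv_of_geometric` at `d = 3`, `cE = Lc^4`) from road S3's symmetric-table rooted rows: `hV` (`m < n`, `θ_V`), `hVt` (top), `hV0` (birth `0`, rate `Lc⁻¹`);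
constants `θ = max θ_V Lc⁻¹`, `C = (Lc^4·(max cV 0 + max CtV 0 + c₀V) + max C₀₁ 0) ∕ θ`, rate the minimum of the four. -/
theorem exists_hUgV_of_rootedRows (hLc : 2 ≤ Lc) {cE : ℝ} (hcE : cE = (Lc : ℝ) ^ (3 + 1)) (cVH : ℝ)
    (hV : ∃ cV θ δ : ℝ, 0 ≤ cV ∧ 0 ≤ θ ∧ θ < 1 ∧ 0 < δ ∧ ∀ (r : Fin (3 + 1) → ℕ), r ∈ box (3 + 1) Lc → ∀ n m : ℕ, m < n →
      LocStencil (fun κ' u' x' z' a b => ((Lc : ℝ) ^ (n + 1 + 1)) ^ (2 * (3 + 1)) *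
        e3OfS (Lc ^ (n + 1 + 1)) (fun κ u => (((Lc : ℝ) ^ (3 + 1)) ^ (n - m) * (cVH * ((Lc : ℝ) ^ (m + 1)) ^ (3 + 2))) •
          pushSum (Lc ^ (m + 1 + 1)) (Lc ^ (n - m)) (borderSum (Lc ^ (m + 1)) (fun κ z => vhSAt (toSite r) 3 Lc rfl κ z) κ u))
        κ' u' x' z' a b) (cV * θ ^ (n - m)) δ)
    (hVt : ∃ CtV δt : ℝ, 0 < δt ∧ ∀ (r : Fin (3 + 1) → ℕ), r ∈ box (3 + 1) Lc → ∀ n : ℕ,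
      LocStencil (fun κ' u' x' z' a b => ((Lc : ℝ) ^ (n + 1 + 1)) ^ (2 * (3 + 1)) *
        e3OfS (Lc ^ (n + 1 + 1)) (fun κ u => (cVH * ((Lc : ℝ) ^ (n + 1)) ^ (3 + 2)) •
          borderSum (Lc ^ (n + 1)) (fun κ z => vhSAt (toSite r) 3 Lc rfl κ z) κ u) κ' u' x' z' a b) CtV δt)
    (hV0 : ∃ c₀V δ0 : ℝ, 0 ≤ c₀V ∧ 0 < δ0 ∧ ∀ (r : Fin (3 + 1) → ℕ), r ∈ box (3 + 1) Lc → ∀ n : ℕ,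
      LocStencil (fun κ' u' x' z' a b => ((Lc : ℝ) ^ (n + 1 + 1)) ^ (2 * (3 + 1)) *
        e3OfS (Lc ^ (n + 1 + 1)) (fun κ u => ((((Lc : ℝ) ^ (3 + 1)) ^ (n + 1)) * cVH) •
          pushSum Lc (Lc ^ (n + 1)) (vhSAt (toSite r) 3 Lc rfl κ u)) κ' u' x' z' a b) (c₀V * ((Lc : ℝ)⁻¹) ^ (n + 1)) δ0) :
    ∃ C θ δ : ℝ, 0 ≤ C ∧ 0 ≤ θ ∧ θ < 1 ∧ 0 < δ ∧ ∀ (rr : Fin (3 + 1) → ℕ), rr ∈ box (3 + 1) Lc → ∀ k i : ℕ, i < k →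
      LocStencil (fun κ' u' => (cE * (Lc : ℝ) ^ (2 * (3 + 1))) ^ (k - i) •
        push₃ (respStep (d := 3) (Lc ^ (i + 1)) (Lc ^ k)) (respStep (d := 3) (Lc ^ (i + 1)) (Lc ^ k)) (respStep (d := 3) (Lc ^ (i + 1)) (Lc ^ k))
          (fun κ u => -(push₃ (-respStep (d := 3) (Lc ^ i) (Lc ^ (i + 1))) (colM (KStepUnit (d := 3) Lc i) Lc)
                (respStep (d := 3) (Lc ^ i) (Lc ^ (i + 1))) (reslot Sum.inl Sum.inr fun κ u => cVH • vhSAt (toSite rr) 3 Lc rfl κ u) κ u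
            + push₃ (rowMM (KStepUnit (d := 3) Lc i) Lc) (respStep (d := 3) (Lc ^ i) (Lc ^ (i + 1)))
                (respStep (d := 3) (Lc ^ i) (Lc ^ (i + 1))) (reslot Sum.inr Sum.inl fun κ u => cVH • vhSAt (toSite rr) 3 Lc rfl κ u) κ u)) κ' u')
        (C * θ ^ (k - i)) δ := by
  have hLc1 : 1 ≤ Lc := le_trans (by norm_num) hLc
  have hLpos : (0 : ℝ) < Lc := by exact_mod_cast Nat.pos_of_ne_zero (NeZero.ne Lc)
  have hL1 : (1 : ℝ) < Lc := by exact_mod_cast (lt_of_lt_of_le (by norm_num) hLc : 1 < Lc)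
  obtain ⟨cV, θV, δV, hcV, hθV0, hθV1, hδV, hV⟩ := hV
  obtain ⟨CtV, δt, hδt, hVt⟩ := hVt
  obtain ⟨c₀V, δ0, hc₀V, hδ0, hV0⟩ := hV0
  obtain ⟨C01, δ01, hδ01, h01⟩ := exists_locStencil_v_member_zero_one (d := 3) hLc1 ((cE * (Lc : ℝ) ^ (2 * (3 + 1))) ^ 1) cVH
  -- the constants
  set A : ℝ := (Lc : ℝ) ^ (3 + 1) with hA
  set θ : ℝ := max θV (Lc : ℝ)⁻¹ with hθ
  set Y : ℝ := A * (max cV 0 + max CtV 0 + c₀V) + max C01 0 with hY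
  have hA0 : 0 ≤ A := by positivity
  have hY0 : 0 ≤ Y := by positivity
  have hι0 : 0 < (Lc : ℝ)⁻¹ := by positivity
  have hι1 : (Lc : ℝ)⁻¹ < 1 := inv_lt_one_of_one_lt₀ hL1
  have hθpos : 0 < θ := lt_of_lt_of_le hι0 (le_max_right _ _)
  have hθ1 : θ < 1 := max_lt hθV1 hι1
  have hkey : ∀ m : ℕ, Y / θ * θ ^ (m + 1) = Y * θ ^ m := by
    intro m
    rw [pow_succ]
    field_simp
  have hpowV : ∀ m : ℕ, θV ^ m ≤ θ ^ m := fun m => pow_le_pow_left₀ hθV0 (le_max_left _ _) m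
  have hpowι : ∀ m : ℕ, ((Lc : ℝ)⁻¹) ^ m ≤ θ ^ m := fun m => pow_le_pow_left₀ hι0.le (le_max_right _ _) m
  refine ⟨Y / θ, θ, min (min δV δt) (min δ0 δ01), by positivity, hθpos.le, hθ1,
    lt_min (lt_min hδV hδt) (lt_min hδ0 hδ01), fun rr hrr k i hik => ?_⟩
  obtain ⟨n, rfl⟩ := Nat.exists_eq_add_of_lt hik
  cases i with
  | zero =>
    cases n with
    | zero =>
      -- the lone member (0, 1)
      rw [show 0 + 0 + 1 = 1 by rfl, show 1 - 0 = 1 by rfl]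
      refine locStencil_mono' (h01 rr hrr) ?_ ((min_le_right _ _).trans (min_le_right _ _))
      rw [show (1 : ℕ) = 0 + 1 by rfl, hkey 0, pow_zero, mul_one]
      exact (le_max_left _ _).trans (le_add_of_nonneg_left (by positivity))
    | succ n =>
      -- birth 0, read n + 2: road S3-V0 (symmetric table) at the root
      rw [show 0 + (n + 1) + 1 - 0 = n + 1 + 1 by omega]
      have hrow := hV0 rr hrr n
      have hc : LocStencil (fun κ' u' => (cE * (Lc : ℝ) ^ (2 * (3 + 1))) ^ (n + 1 + 1) •
          push₃ (respStep (d := 3) (Lc ^ (0 + 1)) (Lc ^ (0 + (n + 1) + 1))) (respStep (d := 3) (Lc ^ (0 + 1)) (Lc ^ (0 + (n + 1) + 1)))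
            (respStep (d := 3) (Lc ^ (0 + 1)) (Lc ^ (0 + (n + 1) + 1)))
            (fun κ u => -(push₃ (-respStep (d := 3) (Lc ^ 0) (Lc ^ (0 + 1))) (colM (KStepUnit (d := 3) Lc 0) Lc)
                  (respStep (d := 3) (Lc ^ 0) (Lc ^ (0 + 1))) (reslot Sum.inl Sum.inr fun κ u => cVH • vhSAt (toSite rr) 3 Lc rfl κ u) κ u
              + push₃ (rowMM (KStepUnit (d := 3) Lc 0) Lc) (respStep (d := 3) (Lc ^ 0) (Lc ^ (0 + 1)))
                  (respStep (d := 3) (Lc ^ 0) (Lc ^ (0 + 1))) (reslot Sum.inr Sum.inl fun κ u => cVH • vhSAt (toSite rr) 3 Lc rfl κ u) κ u)) κ' u')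
          (A * (c₀V * ((Lc : ℝ)⁻¹) ^ (n + 1))) δ0 := by
        intro κ' u' x' z' a b
        have hx := hrow κ' u' x' z' a b
        beta_reduce at hx
        beta_reduce
        rw [lineage_v_zero_pin_apply hLc1 hrr hcE cVH n κ' u' x' z' a b, abs_mul, abs_of_nonneg hA0, mul_assoc]
        exact mul_le_mul_of_nonneg_left hx hA0
      refine locStencil_mono' hc ?_ ((min_le_right _ _).trans (min_le_left _ _))
      rw [hkey (n + 1), ← mul_assoc]
      refine (mul_le_mul_of_nonneg_left (hpowι (n + 1)) (by positivity)).trans (mul_le_mul_of_nonneg_right ?_ (pow_nonneg hθpos.le _))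
      have hb : c₀V ≤ max cV 0 + max CtV 0 + c₀V := by linarith [le_max_right cV 0, le_max_right CtV 0]
      calc A * c₀V ≤ A * (max cV 0 + max CtV 0 + c₀V) := mul_le_mul_of_nonneg_left hb hA0
        _ ≤ Y := le_add_of_nonneg_right (le_max_right _ _)
  | succ j =>
    cases n with
    | zero =>
      -- birth j + 1, read j + 2: road S3-Vt (symmetric table) at the root
      rw [show j + 1 + 0 + 1 = j + 1 + 1 by omega, show j + 1 + 1 - (j + 1) = 1 by omega]
      have hrow := hVt rr hrr j
      have hc : LocStencil (fun κ' u' => (cE * (Lc : ℝ) ^ (2 * (3 + 1))) ^ 1 •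
          push₃ (respStep (d := 3) (Lc ^ (j + 1 + 1)) (Lc ^ (j + 1 + 1))) (respStep (d := 3) (Lc ^ (j + 1 + 1)) (Lc ^ (j + 1 + 1)))
            (respStep (d := 3) (Lc ^ (j + 1 + 1)) (Lc ^ (j + 1 + 1)))
            (fun κ u => -(push₃ (-respStep (d := 3) (Lc ^ (j + 1)) (Lc ^ (j + 1 + 1))) (colM (KStepUnit (d := 3) Lc (j + 1)) Lc)
                  (respStep (d := 3) (Lc ^ (j + 1)) (Lc ^ (j + 1 + 1))) (reslot Sum.inl Sum.inr fun κ u => cVH • vhSAt (toSite rr) 3 Lc rfl κ u) κ u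
              + push₃ (rowMM (KStepUnit (d := 3) Lc (j + 1)) Lc) (respStep (d := 3) (Lc ^ (j + 1)) (Lc ^ (j + 1 + 1)))
                  (respStep (d := 3) (Lc ^ (j + 1)) (Lc ^ (j + 1 + 1))) (reslot Sum.inr Sum.inl fun κ u => cVH • vhSAt (toSite rr) 3 Lc rfl κ u) κ u))
            κ' u') (A * CtV) δt := by
        intro κ' u' x' z' a b
        have hx := hrow κ' u' x' z' a b
        beta_reduce at hx
        beta_reduce
        rw [lineage_v_top_pin_apply hLc1 hrr hcE cVH j κ' u' x' z' a b, abs_mul, abs_of_nonneg hA0, mul_assoc]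
        exact mul_le_mul_of_nonneg_left hx hA0
      refine locStencil_mono' hc ?_ ((min_le_left _ _).trans (min_le_right _ _))
      rw [show (1 : ℕ) = 0 + 1 by rfl, hkey 0, pow_zero, mul_one]
      have hb : CtV ≤ max cV 0 + max CtV 0 + c₀V := by linarith [le_max_left CtV 0, le_max_right cV 0, hc₀V]
      calc A * CtV ≤ A * (max cV 0 + max CtV 0 + c₀V) := mul_le_mul_of_nonneg_left hb hA0
        _ ≤ Y := le_add_of_nonneg_right (le_max_right _ _)
    | succ n =>
      -- birth j + 1, read j + n + 3: road S3-V (symmetric table) at the root, (n′, m) = (j + n + 1, j)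
      rw [show j + 1 + (n + 1) + 1 - (j + 1) = n + 1 + 1 by omega]
      have hrow := hV rr hrr (j + (n + 1)) j (by omega)
      have hc : LocStencil (fun κ' u' => (cE * (Lc : ℝ) ^ (2 * (3 + 1))) ^ (n + 1 + 1) •
          push₃ (respStep (d := 3) (Lc ^ (j + 1 + 1)) (Lc ^ (j + 1 + (n + 1) + 1))) (respStep (d := 3) (Lc ^ (j + 1 + 1)) (Lc ^ (j + 1 + (n + 1) + 1)))
            (respStep (d := 3) (Lc ^ (j + 1 + 1)) (Lc ^ (j + 1 + (n + 1) + 1)))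
            (fun κ u => -(push₃ (-respStep (d := 3) (Lc ^ (j + 1)) (Lc ^ (j + 1 + 1))) (colM (KStepUnit (d := 3) Lc (j + 1)) Lc)
                  (respStep (d := 3) (Lc ^ (j + 1)) (Lc ^ (j + 1 + 1))) (reslot Sum.inl Sum.inr fun κ u => cVH • vhSAt (toSite rr) 3 Lc rfl κ u) κ u
              + push₃ (rowMM (KStepUnit (d := 3) Lc (j + 1)) Lc) (respStep (d := 3) (Lc ^ (j + 1)) (Lc ^ (j + 1 + 1)))
                  (respStep (d := 3) (Lc ^ (j + 1)) (Lc ^ (j + 1 + 1))) (reslot Sum.inr Sum.inl fun κ u => cVH • vhSAt (toSite rr) 3 Lc rfl κ u) κ u))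
            κ' u') (A * (cV * θV ^ (j + (n + 1) - j))) δV := by
        intro κ' u' x' z' a b
        have hx := hrow κ' u' x' z' a b
        beta_reduce at hx
        beta_reduce
        rw [lineage_v_succ_pin_apply hLc1 hrr hcE cVH j n κ' u' x' z' a b, abs_mul, abs_of_nonneg hA0, mul_assoc]
        exact mul_le_mul_of_nonneg_left hx hA0
      refine locStencil_mono' hc ?_ ((min_le_left _ _).trans (min_le_left _ _))
      rw [Nat.add_sub_cancel_left, hkey (n + 1), ← mul_assoc]
      refine (mul_le_mul_of_nonneg_left (hpowV (n + 1)) (by positivity)).trans (mul_le_mul_of_nonneg_right ?_ (pow_nonneg hθpos.le _))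
      have hb : cV ≤ max cV 0 + max CtV 0 + c₀V := by linarith [le_max_left cV 0, le_max_right CtV 0, hc₀V]
      calc A * cV ≤ A * (max cV 0 + max CtV 0 + c₀V) := mul_le_mul_of_nonneg_left hb hA0
        _ ≤ Y := le_add_of_nonneg_right (le_max_right _ _)

/-- NOT IN PRINT; OUR BOOKKEEPING ([folklore]; CONDITIONAL on the three rooted V rows and the V contact letter).  **`hB(cVH, 0)` OF THE `d = 3` COMB FAMILY FROM ROAD S3's
ROOTED SYMMETRIC-TABLE V ROWS AND A POLY-GEOMETRIC CONTACT LETTER** (leaf-01's `BornBorderLetters.exists_hBv_of_geometric_poly` with `hUg := exists_hUgV_of_rootedRows`). -/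
theorem exists_hBv_of_rootedRows_poly (hLc : 2 ≤ Lc) {cE : ℝ} (hcE : cE = (Lc : ℝ) ^ (3 + 1)) (cVH : ℝ) (p : ℕ)
    (hV : ∃ cV θ δ : ℝ, 0 ≤ cV ∧ 0 ≤ θ ∧ θ < 1 ∧ 0 < δ ∧ ∀ (r : Fin (3 + 1) → ℕ), r ∈ box (3 + 1) Lc → ∀ n m : ℕ, m < n →
      LocStencil (fun κ' u' x' z' a b => ((Lc : ℝ) ^ (n + 1 + 1)) ^ (2 * (3 + 1)) *
        e3OfS (Lc ^ (n + 1 + 1)) (fun κ u => (((Lc : ℝ) ^ (3 + 1)) ^ (n - m) * (cVH * ((Lc : ℝ) ^ (m + 1)) ^ (3 + 2))) •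
          pushSum (Lc ^ (m + 1 + 1)) (Lc ^ (n - m)) (borderSum (Lc ^ (m + 1)) (fun κ z => vhSAt (toSite r) 3 Lc rfl κ z) κ u))
        κ' u' x' z' a b) (cV * θ ^ (n - m)) δ)
    (hVt : ∃ CtV δt : ℝ, 0 < δt ∧ ∀ (r : Fin (3 + 1) → ℕ), r ∈ box (3 + 1) Lc → ∀ n : ℕ,
      LocStencil (fun κ' u' x' z' a b => ((Lc : ℝ) ^ (n + 1 + 1)) ^ (2 * (3 + 1)) *
        e3OfS (Lc ^ (n + 1 + 1)) (fun κ u => (cVH * ((Lc : ℝ) ^ (n + 1)) ^ (3 + 2)) •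
          borderSum (Lc ^ (n + 1)) (fun κ z => vhSAt (toSite r) 3 Lc rfl κ z) κ u) κ' u' x' z' a b) CtV δt)
    (hV0 : ∃ c₀V δ0 : ℝ, 0 ≤ c₀V ∧ 0 < δ0 ∧ ∀ (r : Fin (3 + 1) → ℕ), r ∈ box (3 + 1) Lc → ∀ n : ℕ,
      LocStencil (fun κ' u' x' z' a b => ((Lc : ℝ) ^ (n + 1 + 1)) ^ (2 * (3 + 1)) *
        e3OfS (Lc ^ (n + 1 + 1)) (fun κ u => ((((Lc : ℝ) ^ (3 + 1)) ^ (n + 1)) * cVH) •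
          pushSum Lc (Lc ^ (n + 1)) (vhSAt (toSite r) 3 Lc rfl κ u)) κ' u' x' z' a b) (c₀V * ((Lc : ℝ)⁻¹) ^ (n + 1)) δ0)
    (hCg : ∃ C θ δ : ℝ, 0 ≤ C ∧ 0 ≤ θ ∧ θ < 1 ∧ 0 < δ ∧ ∀ (rr : Fin (3 + 1) → ℕ), rr ∈ box (3 + 1) Lc → ∀ k i : ℕ, i < k →
      LocStencil (AffineUnroll.transport (SrecBornSector.unitStepMap Lc (toSite rr) cE) (i + 1) (k - 1 - i)
          (SrecBornSector.unitStepMap Lc (toSite rr) cE i (fun κ u => cVH • vhSAt (toSite rr) 3 Lc rfl κ u))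
        - fun κ' u' => (cE * (Lc : ℝ) ^ (2 * (3 + 1))) ^ (k - i) •
          push₃ (respStep (d := 3) (Lc ^ (i + 1)) (Lc ^ k)) (respStep (d := 3) (Lc ^ (i + 1)) (Lc ^ k)) (respStep (d := 3) (Lc ^ (i + 1)) (Lc ^ k))
            (fun κ u => -(push₃ (-respStep (d := 3) (Lc ^ i) (Lc ^ (i + 1))) (colM (KStepUnit (d := 3) Lc i) Lc)
                  (respStep (d := 3) (Lc ^ i) (Lc ^ (i + 1))) (reslot Sum.inl Sum.inr fun κ u => cVH • vhSAt (toSite rr) 3 Lc rfl κ u) κ u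
              + push₃ (rowMM (KStepUnit (d := 3) Lc i) Lc) (respStep (d := 3) (Lc ^ i) (Lc ^ (i + 1)))
                  (respStep (d := 3) (Lc ^ i) (Lc ^ (i + 1))) (reslot Sum.inr Sum.inl fun κ u => cVH • vhSAt (toSite rr) 3 Lc rfl κ u) κ u)) κ' u')
        (C * (((k - i : ℕ) : ℝ) ^ p * θ ^ (k - i))) δ) :
    ∃ C δ : ℝ, 0 < δ ∧ ∀ (rr : Fin (3 + 1) → ℕ), rr ∈ box (3 + 1) Lc →
      ∀ k : ℕ, LocStencil (unitS (sfStep Lc k) (smStep 3 Lc k) (bornSecAt Lc (toSite rr) cE cVH 0 k)) C δ :=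
  exists_hBv_of_geometric_poly cE cVH p (exists_hUgV_of_rootedRows hLc hcE cVH hV hVt hV0) hCg

end Socket

end Summit.QuantumFields.BalabanUV.Beta.GAN24.BornBorderUndressedRow

end
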